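/-
Copyright (c) 2026. All rights reserved.
Released under Apache 2.0 license as described in the file LICENSE.
-/
import Literature.AlgebraicGeometry.Pohlmann1968.MultiquadraticCMFieldSimpleDegenerateAbelianVarieties
import Literature.AlgebraicGeometry.Pohlmann1968.WeilTypeCMSubfieldExceptionalClasses
import Literature.AlgebraicGeometry.Pohlmann1968.MultiquadraticCMFieldWalshValuesQuadraticSubfields
import HarnessLib

/-!
# Simple abelian varieties with multiquadratic complex multiplication: at least `2·(g + 1 − Rank Φ)` independent
# exceptional WEIL LINES in the middle cohomology — the defect of the Kubota rank counted by Weil-type subfields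

SETTING (tree `DegenerateCMTypesMultiquadraticCMField`, `WeilTypeCMSubfieldExceptionalClasses`, `DivisorClassesCMType`,
`MultiquadraticCMFieldDegreeThirtyTwoRankSpectrum`).  `K` a CM field, Galois over `ℚ` with `Gal(K/ℚ)` of exponent `2`,
`[K:ℚ] = 2g`; `Φ` a CM type with Kubota rank `Rank(Φ)` (`= dim MT(A_Φ)`); `Φ` is BALANCED over an imaginary quadratic
subfield `F ⊆ K` (`(A_Φ, F)` of WEIL TYPE) when over each embedding `τ` of `F` half of its `g` extensions lie in `Φ`.
The tree proved Dodson's constant-weight criterion in the form `Rank(Φ) + #{F imaginary quadratic : Φ balanced over F}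
= g + 1` (`Multiquadratic.cmTypeRank_add_ncard_weilQuadratic_eq`), Pohlmann's dictionary with White's count
`dim Bᵐ(A) − dim Dᵐ(A) = #(pohlmannSets Φ m ∖ pohlmannDivisorSets Φ m)` (`finrank_hodgeClassSpan_sub_finrank_divisorClassesSpan`),
and the Mumford–Pohlmann mechanism `fibre_mem_pohlmannSets_diff`: for a PRIMITIVE `Φ` balanced over `F`, the fibre
`Δ_{F,τ} = {φ : φ|_F = τ}` over a non-real `τ` is a Pohlmann set (a Hodge weight — the Weil classes of `(A, F)`) which
is not a divisor set.  g45-#7 (`MultiquadraticCMFieldNearBentWeilClasses`) ran this count for the near-bent types of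
degree `64` (`16` Weil subfields, `≥ 32` lines).  THIS FILE proves the GENERAL COUNT and reads it in degree `32`:

> **Theorem** (`two_mul_ncard_weilQuadratic_le_finrank_sub`, THE COUNT).  Let `Φ` be a PRIMITIVE CM type of a
> multiquadratic CM field `K` of degree `2g`.  For EVERY realisation `A` of `(K; Φ)`, in degree `m = [K:ℚ]/4 = g/2`:
> **`dim Bᵐ(A) ⊗ ℂ − dim Dᵐ(A) ⊗ ℂ ≥ 2 · #{F ⊆ K imaginary quadratic : Φ balanced over F} = 2·(g + 1 − Rank(Φ))`**
> (`two_mul_sub_cmTypeRank_le_finrank_sub`) — two exceptional Weil lines in the middle cohomology `H^{g}(A)` for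
> every imaginary quadratic subfield over which `A` is of Weil type; the fibres `Δ_{F,τ}` (`= σ(Gal(K/F))` or its
> complement) are pairwise distinct.
> **Theorem** (`twelve_le_finrank_sub_of_finrank_eq_thirtytwo`, DEGREE `32`).  `[K:ℚ] = 32`: every SIMPLE
> DEGENERATE abelian `16`-fold `A` with complex multiplication by `K` (type of rank `11`, tree) is of Weil type over
> exactly `6` imaginary quadratic subfields and has **`dim B⁸(A) − dim D⁸(A) ≥ 12`**: twelve independent exceptional
> Weil lines in `H^{8,8}(A)`, in particular a rational `(8,8)`-class outside `D⁸(A) ⊗ ℂ`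
> (`exists_exceptional_eight_of_finrank_eq_thirtytwo`) — the tree knew an exceptional class «on some power» and «on
> `A` itself for some `m`»; here `m = 8` and at least `12` of them.  Such `A` exist on every `K`
> (`exists_isSimple_sixteenfold_weilLines_of_finrank_eq_thirtytwo`).
> **Theorem** (§3, gen-45 append: `two_le_finrank_sub_of_isSimple_of_not_isNondegenerate`,
> `exists_exceptional_middle_of_isSimple_of_not_isNondegenerate`, `exists_isSimple_middle_weilLines_of_le_finrank`).
> EVERY degree `[K:ℚ] = 4m`: a SIMPLE abelian variety with complex multiplication by a multiquadratic CM field whose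
> type is DEGENERATE has `dim Bᵐ(A) − dim Dᵐ(A) ≥ 2` and a rational `(m,m)`-class outside `Dᵐ(A) ⊗ ℂ` in its MIDDLE
> cohomology (degenerate ⟺ Weil type over some imaginary quadratic subfield, tree); such exist iff `[K:ℚ] ≥ 32` (tree),
> sharpening the tree's `exists_isSimple_exceptional_self_iff_le_finrank` («some `m`») to `m = dim A / 2`.

HONEST SCOPE.  The algebraicity of these Weil classes — the Hodge conjecture for the simple degenerate `16`-folds and
`32`-folds with multiquadratic complex multiplication — is OPEN and not addressed; equality in the count is not
claimed.  Sources: B. B. Gordon [Gordon1999HodgeAVSurvey] 5.13 (ii) (Weil type `(n,n)`: `Hdg = Div + W`), 9.2.2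
(White's count), §9.3; H. Pohlmann [Pohlmann1968] Thm. 1; B. van Geemen [vanGeemen1994HodgeAV] 4.7, Thm. 4.5;
B. Dodson [Dodson1984] §3.1.1 Theorem, §3.2.1; T. Kubota [Kubota1965] §4 Lemma 2; G. Shimura [Shimura1998] §8.2
Prop. 26, §8.4 Example (1).  THEOREMS ONLY: no definition, no named fact, no instance, no `sorry`.

## References

* [Gordon1999HodgeAVSurvey] B. B. Gordon, *A survey of the Hodge conjecture for abelian varieties*, 5.13 (ii), 9.2.2,
  §9.3.
* [Pohlmann1968] H. Pohlmann, *Algebraic cycles on abelian varieties of complex multiplication type*, Ann. of Math.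
  88 (1968), Thm. 1.
* [vanGeemen1994HodgeAV] B. van Geemen, *An introduction to the Hodge conjecture for abelian varieties*, LNM 1594
  (1994), 4.7, Thm. 4.5.
* [Dodson1984] B. Dodson, *The structure of Galois groups of CM-fields*, Trans. AMS 283 (1984), §3.1.1, §3.2.1.
* [Kubota1965] T. Kubota, *On the field extension by complex multiplication*, Trans. AMS 118 (1965), §4 Lemma 2.
* [Shimura1998] G. Shimura, *Abelian Varieties with Complex Multiplication and Modular Functions*, §6.2 Thm. 3,
  §8.2 Prop. 26, §8.4 Example (1).

## Provenance

Lane `lit-hodgefound` (Track 2, Layer A3/A5), seat `lit-hodgefound-p10` generation 45, row g45-#8 (generalises the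
count of g45-#7); neighbours cited by name, nothing restated: `WeilTypeCMSubfieldExceptionalClasses`
(`fibre_mem_pohlmannSets_diff`, `card_fibre_eq_two_mul`, `exists_exceptional_of_fibres_balanced`, USED),
`DivisorClassesCMType` (`finrank_hodgeClassSpan_sub_finrank_divisorClassesSpan`, USED), `DegenerateCMTypesMultiquadraticCMField`
(`Multiquadratic.cmTypeRank_add_ncard_weilQuadratic_eq`, USED), `MultiquadraticCMFieldDegreeThirtyTwoRankSpectrum`
(`cmTypeRank_eq_eleven_of_isSimple_of_not_isNondegenerate`, `isSimple_iff_cmTypeRank_eq_eleven_or_seventeen`, USED),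
`MultiquadraticCMFieldSimpleDegenerateAbelianVarieties` (`exists_isPrimitive_cmTypeRank_eq_eleven`, USED),
`DegenerateCMTypesAbelianCMFieldCyclicSubfields` (`mem_fixingSubgroup_iff_embOf_comp_eq`,
`not_mem_fixingSubgroup_iff_embOf_comp_eq_conjugate`), `CosetGermGaloisSetting` (`CMNumbers.index_fixingSubgroup_eq_two`,
`conjGal_not_mem_fixingSubgroup_iff`), `PrimitiveCMTypeSimple` (`isPrimitive_ringEquiv_complex_iff`),
`SimpleIffPrimitiveCMType` (`isSimple_iff_isPrimitive`), `CMTypeEquivalenceClassesCount`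
(`pattern_primitive_iff_twistStabilizer_eq_bot`), `CMAbelianVarietyRealisedHolds` (`exists_isCMTypeRealisation`).
-/

open scoped BigOperators NumberField IsMulCommutative Classical
open NumberField Module CategoryTheory CategoryTheory.Limits IntermediateField

namespace Literature.AlgebraicGeometry.Pohlmann1968

namespace MultiquadraticWeilLines

open scoped Literature.NumberTheory.ComplexMultiplication
open Literature.NumberTheory.ComplexMultiplication (twistStabilizer IsCMTypeWith conjGal IsPrimitive
  pattern_primitive_iff_twistStabilizer_eq_bot)
open Literature.NumberTheory.ComplexMultiplication.CMNumbers (index_fixingSubgroup_eq_two conjGal_not_mem_fixingSubgroup_iff)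
open Literature.AlgebraicGeometry.Pohlmann1968.AbelianKernels (mem_fixingSubgroup_iff_embOf_comp_eq
  not_mem_fixingSubgroup_iff_embOf_comp_eq_conjugate)
open Literature.AlgebraicGeometry.Pohlmann1968.Multiquadratic
  (cmTypeRank_eq_eleven_of_isSimple_of_not_isNondegenerate isSimple_iff_cmTypeRank_eq_eleven_or_seventeen
  exists_isPrimitive_cmTypeRank_eq_eleven cmTypeRank_add_ncard_weilQuadratic_eq not_isNondegenerate_iff_exists_balanced
  exists_isPrimitive_not_isNondegenerate_iff_le_finrank)
open Literature.AlgebraicGeometry.Motives (CMType AbelianVariety)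
open Literature.AlgebraicGeometry.HodgeTheory
open Literature.AlgebraicGeometry.VanGeemen1994 (hodgeClassSpan)
open Literature.Barriers.HodgeConjecture (divisorClassesSpan)
open Literature.AlgebraicGeometry.ComplexMultiplication (IsCMTypeRealisation exists_isCMTypeRealisation
  isPrimitive_ringEquiv_complex_iff isSimple_iff_isPrimitive)

variable {K : Type} [Field K] [NumberField K] [IsCMField K] [IsGalois ℚ K]
  {A : AbelianVariety ℂ} {ι : 𝓞 K →+* End A} {θ : K →+* Module.End ℂ (complexBetti A.X 1)}

/-! ## §0 Helpers: the fibres over an imaginary quadratic subfield as images of `Gal(K/F)` and of its complement -/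

section Helpers

omit [IsCMField K] in
/-- The fibre of `Hom(K, ℂ) → Hom(F, ℂ)` over `φ₀|_F` is `{σ_s : s ∈ Gal(K/F)}`. [cite: Shimura1998, §8.4 Example (1)] -/
private theorem fibre_eq_image_wl (φ₀ : K →+* ℂ) (F : IntermediateField ℚ K) :
    (Finset.univ.filter fun φ : K →+* ℂ => φ.comp (algebraMap F K) = φ₀.comp (algebraMap F K)) =
      (Finset.univ.filter fun s : K ≃ₐ[ℚ] K => s ∈ F.fixingSubgroup).image (embOf φ₀) := by
  ext φ
  simp only [Finset.mem_filter, Finset.mem_univ, true_and, Finset.mem_image]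
  constructor
  · intro hφ
    obtain ⟨s, rfl⟩ := (embOf_bijective φ₀).2 φ
    exact ⟨s, (mem_fixingSubgroup_iff_embOf_comp_eq φ₀ F s).2 hφ, rfl⟩
  · rintro ⟨s, hs, rfl⟩
    exact (mem_fixingSubgroup_iff_embOf_comp_eq φ₀ F s).1 hs

/-- … and over the conjugate embedding it is `{σ_s : s ∉ Gal(K/F)}` (`F` imaginary quadratic).
[cite: Shimura1998, §8.4 Example (1) and §18.2 Lemma (i)] -/
private theorem fibre_conj_eq_image_wl (hexp : ∀ g : K ≃ₐ[ℚ] K, g ^ 2 = 1) (φ₀ : K →+* ℂ)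
    (F : IntermediateField ℚ K) (h2 : finrank ℚ F = 2) (hF : ¬ IsTotallyReal F) :
    (Finset.univ.filter fun φ : K →+* ℂ =>
        φ.comp (algebraMap F K) = ComplexEmbedding.conjugate (φ₀.comp (algebraMap F K))) =
      (Finset.univ.filter fun s : K ≃ₐ[ℚ] K => s ∉ F.fixingSubgroup).image (embOf φ₀) := by
  haveI := Multiquadratic.isAbelianGalois_of_forall_sq_eq_one hexp
  ext φ
  simp only [Finset.mem_filter, Finset.mem_univ, true_and, Finset.mem_image]
  constructor
  · intro hφ
    obtain ⟨s, rfl⟩ := (embOf_bijective φ₀).2 φ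
    exact ⟨s, (not_mem_fixingSubgroup_iff_embOf_comp_eq_conjugate φ₀ F h2 hF s).2 hφ, rfl⟩
  · rintro ⟨s, hs, rfl⟩
    exact (not_mem_fixingSubgroup_iff_embOf_comp_eq_conjugate φ₀ F h2 hF s).1 hs

omit [IsCMField K] in
/-- `2·|Gal(K/F)| = [K:ℚ]` for a quadratic subfield. [cite: Shimura1998, §8.4 Example (1)] -/
private theorem two_mul_card_filter_mem_fixingSubgroup_wl (φ₀ : K →+* ℂ) (F : IntermediateField ℚ K)
    (h2 : finrank ℚ F = 2) :
    2 * (Finset.univ.filter fun s : K ≃ₐ[ℚ] K => s ∈ F.fixingSubgroup).card = finrank ℚ K := by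
  have hidx := index_fixingSubgroup_eq_two F h2
  have hmul := F.fixingSubgroup.card_mul_index
  have hG : Nat.card (K ≃ₐ[ℚ] K) = finrank ℚ K := by rw [Nat.card_eq_fintype_card, card_gal_eq_finrank φ₀]
  rw [hidx, hG] at hmul
  have hH : 2 * Nat.card (F.fixingSubgroup) = finrank ℚ K := by omega
  rw [Nat.card_eq_fintype_card, Fintype.card_subtype] at hH
  convert hH using 3

omit [IsCMField K] in
/-- … and `2·|Gal(K/ℚ) ∖ Gal(K/F)| = [K:ℚ]`. [cite: Shimura1998, §8.4 Example (1)] -/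
private theorem two_mul_card_filter_not_mem_fixingSubgroup_wl (φ₀ : K →+* ℂ) (F : IntermediateField ℚ K)
    (h2 : finrank ℚ F = 2) :
    2 * (Finset.univ.filter fun s : K ≃ₐ[ℚ] K => s ∉ F.fixingSubgroup).card = finrank ℚ K := by
  have h := Finset.card_filter_add_card_filter_not (s := (Finset.univ : Finset (K ≃ₐ[ℚ] K)))
    (fun s : K ≃ₐ[ℚ] K => s ∈ F.fixingSubgroup)
  have h1 := two_mul_card_filter_mem_fixingSubgroup_wl φ₀ F h2
  rw [Finset.card_univ, card_gal_eq_finrank φ₀] at h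
  omega

/-- `φ₀|_F` is not real for an imaginary quadratic subfield `F` (`ρ ∉ Gal(K/F)`). [cite: Shimura1998, §18.2 Lemma (i)] -/
private theorem conjugate_comp_ne_wl (hexp : ∀ g : K ≃ₐ[ℚ] K, g ^ 2 = 1) (φ₀ : K →+* ℂ)
    (F : IntermediateField ℚ K) (h2 : finrank ℚ F = 2) (hF : ¬ IsTotallyReal F) :
    ComplexEmbedding.conjugate (φ₀.comp (algebraMap F K)) ≠ φ₀.comp (algebraMap F K) := by
  haveI := Multiquadratic.isAbelianGalois_of_forall_sq_eq_one hexp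
  have hρ : (conjGal : K ≃ₐ[ℚ] K) ∉ F.fixingSubgroup := (conjGal_not_mem_fixingSubgroup_iff F).2 hF
  intro h
  have h1 := (not_mem_fixingSubgroup_iff_embOf_comp_eq_conjugate φ₀ F h2 hF (conjGal : K ≃ₐ[ℚ] K)).1 hρ
  rw [h] at h1
  exact hρ ((mem_fixingSubgroup_iff_embOf_comp_eq φ₀ F (conjGal : K ≃ₐ[ℚ] K)).2 h1)

/-- **Balanced ⟹ multiplicity `[K:ℚ]/4`** over both embeddings of the imaginary quadratic `F`.
[cite: Dodson1984, §3.1.1 Theorem] [cite: Gordon1999HodgeAVSurvey, §9.2] -/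
private theorem ncard_eq_wl (hexp : ∀ g : K ≃ₐ[ℚ] K, g ^ 2 = 1) (φ₀ : K →+* ℂ) (Φ : CMType K)
    {m : ℕ} (hm : finrank ℚ K = 4 * m) (F : IntermediateField ℚ K) (h2 : finrank ℚ F = 2) (hF : ¬ IsTotallyReal F)
    (hW : ∀ τ : F →+* ℂ, {φ : K →+* ℂ | φ.comp (algebraMap F K) = τ ∧ φ ∈ Φ.1}.ncard =
      {φ : K →+* ℂ | φ.comp (algebraMap F K) = τ ∧ φ ∉ Φ.1}.ncard) :
    {φ : K →+* ℂ | φ.comp (algebraMap F K) = φ₀.comp (algebraMap F K) ∧ φ ∈ Φ.1}.ncard = m ∧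
      {φ : K →+* ℂ | φ.comp (algebraMap F K) = ComplexEmbedding.conjugate (φ₀.comp (algebraMap F K)) ∧
        φ ∈ Φ.1}.ncard = m := by
  have e1 := card_fibre_eq_two_mul (algebraMap F K) hW (φ₀.comp (algebraMap F K))
  have e2 := card_fibre_eq_two_mul (algebraMap F K) hW (ComplexEmbedding.conjugate (φ₀.comp (algebraMap F K)))
  rw [fibre_eq_image_wl φ₀ F, Finset.card_image_of_injective _ (embOf_bijective φ₀).1] at e1
  rw [fibre_conj_eq_image_wl hexp φ₀ F h2 hF, Finset.card_image_of_injective _ (embOf_bijective φ₀).1] at e2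
  have c1 := two_mul_card_filter_mem_fixingSubgroup_wl φ₀ F h2
  have c2 := two_mul_card_filter_not_mem_fixingSubgroup_wl φ₀ F h2
  constructor <;> omega

end Helpers

/-! ## §1 The count: two exceptional Weil lines per Weil-type imaginary quadratic subfield -/

section Count

/-- **`dim Bᵐ(A) − dim Dᵐ(A) ≥ 2·#{F ⊆ K imaginary quadratic : Φ balanced over F}`, `4m = [K:ℚ]`, FOR EVERY
REALISATION OF A PRIMITIVE CM TYPE OF A MULTIQUADRATIC CM FIELD.**  The fibres `Δ_{F,τ}` (`F` a Weil subfield of `Φ`,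
`τ` one of its two embeddings) — `σ(Gal(K/F))` resp. its complement, `|Δ| = [K:F] = [K:ℚ]/2 = 2m` — are pairwise
distinct Pohlmann sets of degree `m` which are not Pohlmann divisor sets (`Φ` primitive, `τ` non-real): distinct Weil
lines of exceptional Hodge classes in the middle cohomology; White's count finishes.
[cite: Gordon1999HodgeAVSurvey, 9.2.2 and 5.13 (ii)] [cite: Pohlmann1968, Thm. 1] [cite: vanGeemen1994HodgeAV, 4.7] -/
theorem two_mul_ncard_weilQuadratic_le_finrank_sub (hexp : ∀ g : K ≃ₐ[ℚ] K, g ^ 2 = 1) (φ₀ : K →+* ℂ)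
    (Φ : CMType K) (hprim : IsPrimitive (ℂ ≃+* ℂ) Φ.1 φ₀) {m : ℕ} (hm : finrank ℚ K = 4 * m)
    (hA : IsCMTypeRealisation Φ A ι θ) :
    2 * {F : IntermediateField ℚ K | finrank ℚ F = 2 ∧ ¬ IsTotallyReal F ∧
        ∀ τ : F →+* ℂ, {φ : K →+* ℂ | φ.comp (algebraMap F K) = τ ∧ φ ∈ Φ.1}.ncard =
          {φ : K →+* ℂ | φ.comp (algebraMap F K) = τ ∧ φ ∉ Φ.1}.ncard}.ncard ≤
      Module.finrank ℂ ↥(hodgeClassSpan (finrank ℚ K / 2) A.X m) -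
        Module.finrank ℂ ↥(divisorClassesSpan A.X (finrank ℚ K / 2) m) := by
  rw [finrank_hodgeClassSpan_sub_finrank_divisorClassesSpan hA m]
  set W := {F : IntermediateField ℚ K | finrank ℚ F = 2 ∧ ¬ IsTotallyReal F ∧
      ∀ τ : F →+* ℂ, {φ : K →+* ℂ | φ.comp (algebraMap F K) = τ ∧ φ ∈ Φ.1}.ncard =
        {φ : K →+* ℂ | φ.comp (algebraMap F K) = τ ∧ φ ∉ Φ.1}.ncard} with hWdef
  -- the two families of fibres
  set f₁ : IntermediateField ℚ K → Finset (K →+* ℂ) := fun F =>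
    Finset.univ.filter fun φ : K →+* ℂ => φ.comp (algebraMap F K) = φ₀.comp (algebraMap F K) with hf₁
  set f₂ : IntermediateField ℚ K → Finset (K →+* ℂ) := fun F =>
    Finset.univ.filter fun φ : K →+* ℂ =>
      φ.comp (algebraMap F K) = ComplexEmbedding.conjugate (φ₀.comp (algebraMap F K)) with hf₂
  -- both land in the exceptional Pohlmann sets of degree `m`
  have hmem₁ : ∀ F ∈ W, f₁ F ∈ pohlmannSets Φ m \ pohlmannDivisorSets Φ m := by
    intro F hF
    obtain ⟨h2, hFr, hW⟩ := hF
    have h := fibre_mem_pohlmannSets_diff (algebraMap F K) φ₀ hprim hW (conjugate_comp_ne_wl hexp φ₀ F h2 hFr)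
    rwa [(ncard_eq_wl hexp φ₀ Φ hm F h2 hFr hW).1] at h
  have hmem₂ : ∀ F ∈ W, f₂ F ∈ pohlmannSets Φ m \ pohlmannDivisorSets Φ m := by
    intro F hF
    obtain ⟨h2, hFr, hW⟩ := hF
    have hne : ComplexEmbedding.conjugate (ComplexEmbedding.conjugate (φ₀.comp (algebraMap F K))) ≠
        ComplexEmbedding.conjugate (φ₀.comp (algebraMap F K)) := by
      rw [ComplexEmbedding.involutive_conjugate (↥F) (φ₀.comp (algebraMap F K))]
      exact (conjugate_comp_ne_wl hexp φ₀ F h2 hFr).symm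
    have h := fibre_mem_pohlmannSets_diff (algebraMap F K) φ₀ hprim hW hne
    rwa [(ncard_eq_wl hexp φ₀ Φ hm F h2 hFr hW).2] at h
  -- injectivity: the fibre determines `Gal(K/F)`, hence `F`
  have hinj₁ : Set.InjOn f₁ W := by
    intro F hF F' hF' hFF'
    have h : F.fixingSubgroup = F'.fixingSubgroup := by
      ext s
      have e : (Finset.univ.filter fun s : K ≃ₐ[ℚ] K => s ∈ F.fixingSubgroup) =
          Finset.univ.filter fun s : K ≃ₐ[ℚ] K => s ∈ F'.fixingSubgroup := by
        rw [← Finset.image_inj (f := embOf φ₀) (embOf_bijective φ₀).1, ← fibre_eq_image_wl φ₀ F,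
          ← fibre_eq_image_wl φ₀ F']
        exact hFF'
      have := Finset.ext_iff.1 e s
      simpa using this
    rw [← IsGalois.fixedField_fixingSubgroup F, ← IsGalois.fixedField_fixingSubgroup F', h]
  have hinj₂ : Set.InjOn f₂ W := by
    intro F hF F' hF' hFF'
    have h : F.fixingSubgroup = F'.fixingSubgroup := by
      ext s
      have e : (Finset.univ.filter fun s : K ≃ₐ[ℚ] K => s ∉ F.fixingSubgroup) =
          Finset.univ.filter fun s : K ≃ₐ[ℚ] K => s ∉ F'.fixingSubgroup := by
        rw [← Finset.image_inj (f := embOf φ₀) (embOf_bijective φ₀).1,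
          ← fibre_conj_eq_image_wl hexp φ₀ F hF.1 hF.2.1, ← fibre_conj_eq_image_wl hexp φ₀ F' hF'.1 hF'.2.1]
        exact hFF'
      have := Finset.ext_iff.1 e s
      simp only [Finset.mem_filter, Finset.mem_univ, true_and] at this
      tauto
    rw [← IsGalois.fixedField_fixingSubgroup F, ← IsGalois.fixedField_fixingSubgroup F', h]
  -- disjointness: `φ₀ ∈ f₁ F`, `φ₀ ∉ f₂ F'`
  have hdisj : Disjoint (f₁ '' W) (f₂ '' W) := by
    rw [Set.disjoint_left]
    rintro Δ ⟨F, -, rfl⟩ ⟨F', hF', hFF'⟩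
    have hφ₀ : φ₀ ∈ f₁ F := by
      simp only [hf₁, Finset.mem_filter, Finset.mem_univ, true_and]
    rw [← hFF'] at hφ₀
    simp only [hf₂, Finset.mem_filter, Finset.mem_univ, true_and] at hφ₀
    exact conjugate_comp_ne_wl hexp φ₀ F' hF'.1 hF'.2.1 hφ₀.symm
  -- count
  have hsub : f₁ '' W ∪ f₂ '' W ⊆ pohlmannSets Φ m \ pohlmannDivisorSets Φ m := by
    rintro Δ (⟨F, hF, rfl⟩ | ⟨F, hF, rfl⟩)
    · exact hmem₁ F hF
    · exact hmem₂ F hF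
  calc 2 * W.ncard = W.ncard + W.ncard := by ring
    _ = (f₁ '' W).ncard + (f₂ '' W).ncard := by rw [hinj₁.ncard_image, hinj₂.ncard_image]
    _ = (f₁ '' W ∪ f₂ '' W).ncard := (Set.ncard_union_eq hdisj (Set.toFinite _) (Set.toFinite _)).symm
    _ ≤ (pohlmannSets Φ m \ pohlmannDivisorSets Φ m).ncard := Set.ncard_le_ncard hsub (Set.toFinite _)

/-- **`dim Bᵐ(A) − dim Dᵐ(A) ≥ 2·(2m + 1 − Rank(Φ))`, `4m = [K:ℚ]`** (the previous count with Dodson's rank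
formula `Rank(Φ) + #{Weil subfields} = [K:ℚ]/2 + 1`): the DEFECT of the Kubota rank of a primitive type is seen twice
over in exceptional Weil lines of the middle cohomology. [cite: Dodson1984, §3.1.1 Theorem] [cite: Kubota1965, §4 Lemma 2]
[cite: Gordon1999HodgeAVSurvey, 9.2.2] -/
theorem two_mul_sub_cmTypeRank_le_finrank_sub (hexp : ∀ g : K ≃ₐ[ℚ] K, g ^ 2 = 1) (φ₀ : K →+* ℂ)
    (Φ : CMType K) (hprim : IsPrimitive (ℂ ≃+* ℂ) Φ.1 φ₀) {m : ℕ} (hm : finrank ℚ K = 4 * m)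
    (hA : IsCMTypeRealisation Φ A ι θ) :
    2 * (finrank ℚ K / 2 + 1 - cmTypeRank Φ) ≤
      Module.finrank ℂ ↥(hodgeClassSpan (finrank ℚ K / 2) A.X m) -
        Module.finrank ℂ ↥(divisorClassesSpan A.X (finrank ℚ K / 2) m) := by
  have h := two_mul_ncard_weilQuadratic_le_finrank_sub hexp φ₀ Φ hprim hm hA
  have hr := cmTypeRank_add_ncard_weilQuadratic_eq hexp Φ
  have e : finrank ℚ K / 2 + 1 - cmTypeRank Φ =
      {F : IntermediateField ℚ K | finrank ℚ F = 2 ∧ ¬ IsTotallyReal F ∧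
        ∀ τ : F →+* ℂ, {φ : K →+* ℂ | φ.comp (algebraMap F K) = τ ∧ φ ∈ Φ.1}.ncard =
          {φ : K →+* ℂ | φ.comp (algebraMap F K) = τ ∧ φ ∉ Φ.1}.ncard}.ncard := by omega
  rw [e]
  exact h

/-- The same for a CM type with TRIVIAL TWIST STABILISER (`Stab(Φ) = ⊥`, the tree's primitivity dictionary).
[cite: Shimura1998, §8.2 Prop. 26] [cite: Gordon1999HodgeAVSurvey, 9.2.2] -/
theorem two_mul_sub_cmTypeRank_le_finrank_sub_of_twistStabilizer_eq_bot (hexp : ∀ g : K ≃ₐ[ℚ] K, g ^ 2 = 1)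
    (Φ : CMType K) (hbot : twistStabilizer Φ = ⊥) {m : ℕ} (hm : finrank ℚ K = 4 * m)
    (hA : IsCMTypeRealisation Φ A ι θ) :
    2 * (finrank ℚ K / 2 + 1 - cmTypeRank Φ) ≤
      Module.finrank ℂ ↥(hodgeClassSpan (finrank ℚ K / 2) A.X m) -
        Module.finrank ℂ ↥(divisorClassesSpan A.X (finrank ℚ K / 2) m) := by
  obtain ⟨φ₀⟩ := (inferInstance : Nonempty (K →+* ℂ))
  exact two_mul_sub_cmTypeRank_le_finrank_sub hexp φ₀ Φ
    ((isPrimitive_ringEquiv_complex_iff Φ φ₀).2 ((pattern_primitive_iff_twistStabilizer_eq_bot Φ).2 hbot)) hm hA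

/-- The same for a SIMPLE abelian variety of type `(K; Φ)` (simple ⟺ primitive, Shimura §8.2 Prop. 26, tree).
[cite: Shimura1998, §8.2 Prop. 26] [cite: Gordon1999HodgeAVSurvey, 9.2.2] -/
theorem two_mul_sub_cmTypeRank_le_finrank_sub_of_isSimple (hexp : ∀ g : K ≃ₐ[ℚ] K, g ^ 2 = 1)
    (Φ : CMType K) {m : ℕ} (hm : finrank ℚ K = 4 * m) (hA : IsCMTypeRealisation Φ A ι θ) (hs : A.IsSimple) :
    2 * (finrank ℚ K / 2 + 1 - cmTypeRank Φ) ≤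
      Module.finrank ℂ ↥(hodgeClassSpan (finrank ℚ K / 2) A.X m) -
        Module.finrank ℂ ↥(divisorClassesSpan A.X (finrank ℚ K / 2) m) := by
  obtain ⟨φ₀⟩ := (inferInstance : Nonempty (K →+* ℂ))
  exact two_mul_sub_cmTypeRank_le_finrank_sub hexp φ₀ Φ ((isSimple_iff_isPrimitive hA φ₀).1 hs) hm hA

end Count

/-! ## §2 Degree `32`: the simple degenerate `16`-folds carry twelve exceptional Weil lines in `H^{8,8}` -/

section ThirtyTwo

/-- **`[K:ℚ] = 32`: A SIMPLE DEGENERATE ABELIAN `16`-FOLD WITH COMPLEX MULTIPLICATION BY `K` IS OF WEIL TYPE OVER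
EXACTLY `6` IMAGINARY QUADRATIC SUBFIELDS** (its type has rank `11 = 17 − 6`). [cite: Dodson1984, §3.1.1 Theorem and §3.2.1]
[cite: Kubota1965, §4 Lemma 2] -/
theorem ncard_weilQuadratic_eq_six_of_isSimple_of_not_isNondegenerate (hexp : ∀ g : K ≃ₐ[ℚ] K, g ^ 2 = 1)
    (h32 : finrank ℚ K = 32) (Φ : CMType K) (hA : IsCMTypeRealisation Φ A ι θ) (hs : A.IsSimple)
    (hnd : ¬ IsNondegenerate Φ) :
    {F : IntermediateField ℚ K | finrank ℚ F = 2 ∧ ¬ IsTotallyReal F ∧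
        ∀ τ : F →+* ℂ, {φ : K →+* ℂ | φ.comp (algebraMap F K) = τ ∧ φ ∈ Φ.1}.ncard =
          {φ : K →+* ℂ | φ.comp (algebraMap F K) = τ ∧ φ ∉ Φ.1}.ncard}.ncard = 6 := by
  have hr := cmTypeRank_eq_eleven_of_isSimple_of_not_isNondegenerate hexp h32 Φ hA hs hnd
  have h := cmTypeRank_add_ncard_weilQuadratic_eq hexp Φ
  rw [hr, h32] at h
  omega

/-- **`[K:ℚ] = 32`: `dim B⁸(A) − dim D⁸(A) ≥ 12` FOR EVERY SIMPLE DEGENERATE ABELIAN `16`-FOLD `A` WITH COMPLEX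
MULTIPLICATION BY `K`** — twelve independent exceptional Weil lines in the middle cohomology `H¹⁶(A) = H^{8,8}`, two
for each of its six Weil-type imaginary quadratic subfields. [cite: Gordon1999HodgeAVSurvey, 9.2.2 and 5.13 (ii)]
[cite: Pohlmann1968, Thm. 1] [cite: Dodson1984, §3.2.1] -/
theorem twelve_le_finrank_sub_of_finrank_eq_thirtytwo (hexp : ∀ g : K ≃ₐ[ℚ] K, g ^ 2 = 1) (h32 : finrank ℚ K = 32)
    (Φ : CMType K) (hA : IsCMTypeRealisation Φ A ι θ) (hs : A.IsSimple) (hnd : ¬ IsNondegenerate Φ) :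
    12 ≤ Module.finrank ℂ ↥(hodgeClassSpan (finrank ℚ K / 2) A.X 8) -
        Module.finrank ℂ ↥(divisorClassesSpan A.X (finrank ℚ K / 2) 8) := by
  have h := two_mul_sub_cmTypeRank_le_finrank_sub_of_isSimple hexp Φ (m := 8) (by rw [h32]) hA hs
  have hr := cmTypeRank_eq_eleven_of_isSimple_of_not_isNondegenerate hexp h32 Φ hA hs hnd
  have e : 2 * (finrank ℚ K / 2 + 1 - cmTypeRank Φ) = 12 := by rw [hr, h32]
  rw [e] at h
  exact h

/-- **… in particular a rational `(8,8)`-class outside `D⁸(A) ⊗ ℂ`** on every simple degenerate `16`-fold with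
complex multiplication by `K` (`[K:ℚ] = 32`): the Weil class of any of its six Weil subfields.
[cite: Gordon1999HodgeAVSurvey, 5.13 (ii) and 9.2.2] [cite: vanGeemen1994HodgeAV, Thm. 4.5 and 4.7] [cite: Pohlmann1968, Thm. 1] -/
theorem exists_exceptional_eight_of_finrank_eq_thirtytwo (hexp : ∀ g : K ≃ₐ[ℚ] K, g ^ 2 = 1)
    (h32 : finrank ℚ K = 32) (Φ : CMType K) (hA : IsCMTypeRealisation Φ A ι θ) (hs : A.IsSimple)
    (hnd : ¬ IsNondegenerate Φ) :
    ∃ c : complexBetti A.X (2 * 8), IsRationalClass c ∧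
      IsOfHodgeType (finrank ℚ K / 2) A.X (2 * 8) 8 8 c ∧ c ∉ divisorClassesSpan A.X (finrank ℚ K / 2) 8 := by
  obtain ⟨φ₀⟩ := (inferInstance : Nonempty (K →+* ℂ))
  have hprim : IsPrimitive (ℂ ≃+* ℂ) Φ.1 φ₀ := (isSimple_iff_isPrimitive hA φ₀).1 hs
  have hW6 := ncard_weilQuadratic_eq_six_of_isSimple_of_not_isNondegenerate hexp h32 Φ hA hs hnd
  obtain ⟨F, h2, hFr, hW⟩ := Set.nonempty_of_ncard_ne_zero (by rw [hW6]; norm_num)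
  have h := exists_exceptional_of_fibres_balanced (algebraMap F K) φ₀ hprim hW
    (conjugate_comp_ne_wl hexp φ₀ F h2 hFr) hA
  rwa [(ncard_eq_wl hexp φ₀ Φ (m := 8) (by rw [h32]) F h2 hFr hW).1] at h

/-- **EXISTENCE** (`[K:ℚ] = 32`): every multiquadratic CM field of degree `32` has a CM type (primitive, rank `11`) ALL
of whose abelian varieties are simple `16`-folds of Weil type over exactly `6` imaginary quadratic subfields with
`dim B⁸ − dim D⁸ ≥ 12`; and such an abelian variety exists (Shimura §6.2 Thm. 3, tree).
[cite: Shimura1998, §6.2 Thm. 3] [cite: Gordon1999HodgeAVSurvey, 9.2.2 and §9.3] [cite: Dodson1984, §3.2.1] -/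
theorem exists_isSimple_sixteenfold_weilLines_of_finrank_eq_thirtytwo (hexp : ∀ g : K ≃ₐ[ℚ] K, g ^ 2 = 1)
    (h32 : finrank ℚ K = 32) :
    ∃ (Φ : CMType K) (A : AbelianVariety ℂ) (ι : 𝓞 K →+* End A) (θ : K →+* Module.End ℂ (complexBetti A.X 1)),
      IsCMTypeRealisation Φ A ι θ ∧ cmTypeRank Φ = 11 ∧ A.IsSimple ∧ A.dim = 16 ∧
        12 ≤ Module.finrank ℂ ↥(hodgeClassSpan (finrank ℚ K / 2) A.X 8) -
          Module.finrank ℂ ↥(divisorClassesSpan A.X (finrank ℚ K / 2) 8) := by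
  obtain ⟨Φ, hr, hnd, hprim⟩ := exists_isPrimitive_cmTypeRank_eq_eleven hexp h32
  obtain ⟨A, ι, θ, hA⟩ := exists_isCMTypeRealisation Φ
  have hs : A.IsSimple := (isSimple_iff_cmTypeRank_eq_eleven_or_seventeen hexp h32 Φ hA).2 (Or.inl hr)
  have hdim : A.dim = finrank ℚ K / 2 := Literature.AlgebraicGeometry.Motives.schemeDim_eq_holds hA.1
  exact ⟨Φ, A, ι, θ, hA, hr, hs, by rw [hdim, h32],
    twelve_le_finrank_sub_of_finrank_eq_thirtytwo hexp h32 Φ hA hs hnd⟩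

end ThirtyTwo

/-! ## §3 Every degree: a simple DEGENERATE abelian variety with multiquadratic complex multiplication carries an
exceptional Weil class in its MIDDLE cohomology (gen 45 append, g45-#9) -/

section Middle

/-- **`dim Bᵐ(A) − dim Dᵐ(A) ≥ 2` IN THE MIDDLE DEGREE `4m = [K:ℚ]` for every SIMPLE abelian variety `A` with complex
multiplication by a multiquadratic CM field `K` whose type is DEGENERATE**: degenerate ⟺ of Weil type over SOME
imaginary quadratic subfield (tree `not_isNondegenerate_iff_exists_balanced`), whose two fibres are exceptional Weil
lines. [cite: Gordon1999HodgeAVSurvey, 5.13 (ii) and 9.2.2] [cite: Dodson1984, §3.1.1 Theorem] [cite: Pohlmann1968, Thm. 1] -/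
theorem two_le_finrank_sub_of_isSimple_of_not_isNondegenerate (hexp : ∀ g : K ≃ₐ[ℚ] K, g ^ 2 = 1) (Φ : CMType K)
    {m : ℕ} (hm : finrank ℚ K = 4 * m) (hA : IsCMTypeRealisation Φ A ι θ) (hs : A.IsSimple)
    (hnd : ¬ IsNondegenerate Φ) :
    2 ≤ Module.finrank ℂ ↥(hodgeClassSpan (finrank ℚ K / 2) A.X m) -
        Module.finrank ℂ ↥(divisorClassesSpan A.X (finrank ℚ K / 2) m) := by
  obtain ⟨φ₀⟩ := (inferInstance : Nonempty (K →+* ℂ))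
  have hprim : IsPrimitive (ℂ ≃+* ℂ) Φ.1 φ₀ := (isSimple_iff_isPrimitive hA φ₀).1 hs
  have h := two_mul_ncard_weilQuadratic_le_finrank_sub hexp φ₀ Φ hprim hm hA
  obtain ⟨F, hF⟩ := (not_isNondegenerate_iff_exists_balanced hexp Φ).1 hnd
  haveI : Finite (IntermediateField ℚ K) :=
    Field.finite_intermediateField_of_exists_primitive_element ℚ K (Field.exists_primitive_element ℚ K)
  have hpos : 0 < {F : IntermediateField ℚ K | finrank ℚ F = 2 ∧ ¬ IsTotallyReal F ∧
      ∀ τ : F →+* ℂ, {φ : K →+* ℂ | φ.comp (algebraMap F K) = τ ∧ φ ∈ Φ.1}.ncard =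
        {φ : K →+* ℂ | φ.comp (algebraMap F K) = τ ∧ φ ∉ Φ.1}.ncard}.ncard :=
    (Set.ncard_pos (Set.toFinite _)).2 ⟨F, hF⟩
  omega

/-- **AN EXCEPTIONAL `(m,m)`-CLASS IN THE MIDDLE COHOMOLOGY**, `4m = [K:ℚ]`, on every simple abelian variety with
complex multiplication by a multiquadratic CM field whose type is degenerate: the Weil class of an imaginary quadratic
subfield over which it is of Weil type (the tree's `exists_isSimple_exceptional_self_iff_le_finrank` gave «some `m`»;
here `m = dim A / 2`). [cite: Gordon1999HodgeAVSurvey, 5.13 (ii) and 9.2.2] [cite: vanGeemen1994HodgeAV, Thm. 4.5 and 4.7]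
[cite: Pohlmann1968, Thm. 1] -/
theorem exists_exceptional_middle_of_isSimple_of_not_isNondegenerate (hexp : ∀ g : K ≃ₐ[ℚ] K, g ^ 2 = 1)
    (Φ : CMType K) {m : ℕ} (hm : finrank ℚ K = 4 * m) (hA : IsCMTypeRealisation Φ A ι θ) (hs : A.IsSimple)
    (hnd : ¬ IsNondegenerate Φ) :
    ∃ c : complexBetti A.X (2 * m), IsRationalClass c ∧
      IsOfHodgeType (finrank ℚ K / 2) A.X (2 * m) m m c ∧ c ∉ divisorClassesSpan A.X (finrank ℚ K / 2) m := by
  obtain ⟨φ₀⟩ := (inferInstance : Nonempty (K →+* ℂ))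
  have hprim : IsPrimitive (ℂ ≃+* ℂ) Φ.1 φ₀ := (isSimple_iff_isPrimitive hA φ₀).1 hs
  obtain ⟨F, h2, hFr, hW⟩ := (not_isNondegenerate_iff_exists_balanced hexp Φ).1 hnd
  have h := exists_exceptional_of_fibres_balanced (algebraMap F K) φ₀ hprim hW
    (conjugate_comp_ne_wl hexp φ₀ F h2 hFr) hA
  rwa [(ncard_eq_wl hexp φ₀ Φ hm F h2 hFr hW).1] at h

/-- **EXISTENCE IN EVERY DEGREE `[K:ℚ] = 4m ≥ 32`**: a multiquadratic CM field of degree `≥ 32` carries a primitive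
degenerate CM type (tree `exists_isPrimitive_not_isNondegenerate_iff_le_finrank`); every abelian variety of that type
is a SIMPLE abelian variety of dimension `2m` with `dim Bᵐ − dim Dᵐ ≥ 2` — exceptional Weil classes in the middle
cohomology — and such abelian varieties exist. [cite: Shimura1998, §6.2 Thm. 3 and §8.2 Prop. 26]
[cite: Gordon1999HodgeAVSurvey, 9.2.2 and §9.3] [cite: Dodson1984, §3.2.1] -/
theorem exists_isSimple_middle_weilLines_of_le_finrank (hexp : ∀ g : K ≃ₐ[ℚ] K, g ^ 2 = 1) {m : ℕ}
    (hm : finrank ℚ K = 4 * m) (h32 : 32 ≤ finrank ℚ K) :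
    ∃ (Φ : CMType K) (A : AbelianVariety ℂ) (ι : 𝓞 K →+* End A) (θ : K →+* Module.End ℂ (complexBetti A.X 1)),
      IsCMTypeRealisation Φ A ι θ ∧ ¬ IsNondegenerate Φ ∧ A.IsSimple ∧ A.dim = 2 * m ∧
        2 ≤ Module.finrank ℂ ↥(hodgeClassSpan (finrank ℚ K / 2) A.X m) -
          Module.finrank ℂ ↥(divisorClassesSpan A.X (finrank ℚ K / 2) m) := by
  obtain ⟨φ₀⟩ := (inferInstance : Nonempty (K →+* ℂ))
  obtain ⟨Φ, hprim, hnd⟩ := (exists_isPrimitive_not_isNondegenerate_iff_le_finrank hexp φ₀).2 h32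
  obtain ⟨A, ι, θ, hA⟩ := exists_isCMTypeRealisation Φ
  have hs : A.IsSimple := (isSimple_iff_isPrimitive hA φ₀).2 hprim
  have hdim : A.dim = finrank ℚ K / 2 := Literature.AlgebraicGeometry.Motives.schemeDim_eq_holds hA.1
  exact ⟨Φ, A, ι, θ, hA, hnd, hs, by rw [hdim, hm]; omega,
    two_le_finrank_sub_of_isSimple_of_not_isNondegenerate hexp Φ hm hA hs hnd⟩

end Middle

end MultiquadraticWeilLines

end Literature.AlgebraicGeometry.Pohlmann1968
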